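import Literature.Analysis.FluidPDE.TorusWordSpaceTime
import Literature.Analysis.FluidPDE.TorusWordL2Bounds
import Literature.Analysis.FluidPDE.CompressibleEulerLinearizedDerivative
import HarnessLib

/-!
# Word derivatives through the vector calculus of the torus: coordinates, sums, gradient,
# divergence; scalar commutator expansion

Analysis/FluidPDE support file (everything proved; no named facts), sequel of `TorusWordSpaceTime`
and `TorusWordL2Bounds`. Differentiating a first-order system along a word `w` commutes `∂^w`
with the algebraic/differential operations of the system; this file records, for smooth fields,

* `wordDeriv_fun_finset_sum` — `∂^w (∑ᵢ fᵢ) = ∑ᵢ ∂^w fᵢ`;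
* `wordDeriv_apply_coord` — `(∂^w u)(x)ᵢ = ∂^w (uᵢ)(x)`;
* `wordDeriv_gradient_comm`, `wordDeriv_divergence_comm` — `∂^w ∇r = ∇ ∂^w r`,
  `∂^w (div u) = div (∂^w u)` (from `CompressibleEulerLinearizedDerivative.partialDeriv_gradient_eq`,
  `partialDeriv_divergence_eq`, letter by letter);
* `lowComm`, `lowCommS` — the lower commutator sums `∑_{(α,β) ∈ lowerSplits w} ∂^α a · ∂^β f`
  (scalar and scalar-times-vector) with `wordDeriv_mul_eq_top_add_lowComm`,
  `wordDeriv_smul_eq_top_add_lowCommS` and their smoothness.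

## References

* A. Majda, *Compressible Fluid Flow and Systems of Conservation Laws in Several Space
  Variables*, Springer 1984, Ch. 2 §2.1, proof of Thm 2.2. [`Majda1984`]
-/

noncomputable section

open Set Function
open scoped ContDiff

namespace Literature.Analysis.FluidPDE

namespace Torus

open FunctionSpaces FunctionSpaces.Torus CompressibleEuler

variable {d : Type*} [Fintype d] [DecidableEq d] {F : Type*} [NormedAddCommGroup F] [NormedSpace ℝ F]

/-! ## Sums and coordinates -/

/-- `∂^w (∑ᵢ fᵢ) = ∑ᵢ ∂^w fᵢ` for smooth `fᵢ`. [folklore] -/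
theorem wordDeriv_fun_finset_sum {ι : Type*} (s : Finset ι) {f : ι → UnitAddTorus d → F} (hf : ∀ i ∈ s, IsSmooth (f i)) :
    ∀ w : List d, wordDeriv w (fun y => ∑ i ∈ s, f i y) = fun y => ∑ i ∈ s, wordDeriv w (f i) y
  | [] => rfl
  | j :: w => by
      rw [wordDeriv_cons, wordDeriv_fun_finset_sum s hf w]
      funext x
      rw [partialDeriv_finset_sum s (fun i hi => ((isSmooth_wordDeriv (hf i hi) w).isContDiff (by simp))) j x]
      rfl

/-- `(∂^w u)(x)ᵢ = ∂^w (uᵢ)(x)` for smooth vector fields. [folklore] -/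
theorem wordDeriv_apply_coord {u : UnitAddTorus d → EuclideanSpace ℝ d} (hu : IsSmooth u) (i : d) :
    ∀ (w : List d) (x : UnitAddTorus d), wordDeriv w u x i = wordDeriv w (fun y => u y i) x
  | [], _ => rfl
  | j :: w, x => by
      rw [wordDeriv_cons, wordDeriv_cons, ← partialDeriv_apply_coord ((isSmooth_wordDeriv hu w).isContDiff (by simp)) j x i]
      congr 1
      funext y
      exact wordDeriv_apply_coord hu i w y

/-- `∂^w ∇r = ∇ ∂^w r` for smooth `r`. [folklore] -/
theorem wordDeriv_gradient_comm {r : UnitAddTorus d → ℝ} (hr : IsSmooth r) :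
    ∀ w : List d, wordDeriv w (Torus.gradient r) = Torus.gradient (wordDeriv w r)
  | [] => rfl
  | j :: w => by
      rw [wordDeriv_cons, wordDeriv_cons, wordDeriv_gradient_comm hr w]
      funext x
      exact partialDeriv_gradient_eq (isSmooth_wordDeriv hr w) j x

/-- `∂^w (div u) = div (∂^w u)` for smooth `u`. [folklore] -/
theorem wordDeriv_divergence_comm {u : UnitAddTorus d → EuclideanSpace ℝ d} (hu : IsSmooth u) :
    ∀ w : List d, wordDeriv w (Torus.divergence u) = Torus.divergence (wordDeriv w u)
  | [] => rfl
  | j :: w => by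
      rw [wordDeriv_cons, wordDeriv_cons, wordDeriv_divergence_comm hu w]
      funext x
      exact partialDeriv_divergence_eq (isSmooth_wordDeriv hu w) j x

/-! ## The lower commutator sums -/

/-- The lower commutator sum `∑_{(α,β) ∈ lowerSplits w} ∂^α a · ∂^β f` (scalars). [folklore] -/
def lowComm (w : List d) (a f : UnitAddTorus d → ℝ) (x : UnitAddTorus d) : ℝ :=
  ((lowerSplits w).map fun p => fun y => wordDeriv p.1 a y * wordDeriv p.2 f y).sum x

/-- The lower commutator sum `∑_{(α,β) ∈ lowerSplits w} ∂^α a • ∂^β U` (scalar times vector). [folklore] -/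
def lowCommS (w : List d) (a : UnitAddTorus d → ℝ) (U : UnitAddTorus d → F) (x : UnitAddTorus d) : F :=
  ((lowerSplits w).map fun p => fun y => wordDeriv p.1 a y • wordDeriv p.2 U y).sum x

/-- **Commutator expansion, scalar times vector**: `∂^w(a • U) = a • ∂^w U + lowCommS w a U`. [folklore] -/
theorem wordDeriv_smul_eq_top_add_lowCommS {a : UnitAddTorus d → ℝ} {U : UnitAddTorus d → F} (ha : IsSmooth a)
    (hU : IsSmooth U) (w : List d) (x : UnitAddTorus d) :
    wordDeriv w (fun y => a y • U y) x = a x • wordDeriv w U x + lowCommS w a U x := by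
  rw [wordDeriv_smul_eq_top_add_lower ha hU w]
  rfl

/-- **Commutator expansion, scalars**: `∂^w(a f) = a ∂^w f + lowComm w a f`. [folklore] -/
theorem wordDeriv_mul_eq_top_add_lowComm {a f : UnitAddTorus d → ℝ} (ha : IsSmooth a) (hf : IsSmooth f) (w : List d)
    (x : UnitAddTorus d) :
    wordDeriv w (fun y => a y * f y) x = a x * wordDeriv w f x + lowComm w a f x := by
  have h := wordDeriv_smul_eq_top_add_lowCommS ha hf w x
  simp only [smul_eq_mul] at h
  rw [h]
  unfold lowComm lowCommS
  simp only [smul_eq_mul]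

/-- The lower commutator sums are smooth. [folklore] -/
theorem isSmooth_lowCommS {a : UnitAddTorus d → ℝ} {U : UnitAddTorus d → F} (ha : IsSmooth a) (hU : IsSmooth U)
    (w : List d) : IsSmooth (lowCommS w a U) := by
  unfold lowCommS
  exact isSmooth_list_sum _ fun p _ => (isSmooth_wordDeriv ha p.1).smul' (isSmooth_wordDeriv hU p.2)

/-- The lower commutator sums are smooth (scalars). [folklore] -/
theorem isSmooth_lowComm {a f : UnitAddTorus d → ℝ} (ha : IsSmooth a) (hf : IsSmooth f) (w : List d) :
    IsSmooth (lowComm w a f) := by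
  have h := isSmooth_lowCommS ha hf w
  have e : lowComm w a f = lowCommS w a f := by
    funext x; unfold lowComm lowCommS; simp only [smul_eq_mul]
  rw [e]; exact h

end Torus

end Literature.Analysis.FluidPDE

end
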